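import Mathlib
import Summits.KontsevichZagierPeriods.Zeta5Search.BigPrimeDivisibility
import HarnessLib

/-!
# ζ(5) search — (W∞) below `b₀`, part 1: the support-restricted partial-fraction identity

Cell `pub-zeta5` (HONEST FRAMING: systematic search; no irrationality claim unless certified), typer seat
generation 7.  Refinement of `BigPrimePoles.lean` that removes the restriction `p > b₀` from the big-prime
divisibility theorem (W∞) (theorems in `BigPrimeBelowB0.lean`).  Idea (Zudilin's grouping of the very-well-poised
summand, JTNB 16 (2004) §8, (8.7); here only as bookkeeping of OUR object `R_b`): the written denominator
`∏_{s ≤ n}(y+s)^6` of `R_b` over-counts — after DROPPING one slot `j₁` (its two Pochhammer factors stay polynomial) the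
six remaining reciprocal blocks all lie inside the SUPPORT `S = block n β_{j₂} = [β_{j₂}, n − β_{j₂}]` of a slot `j₂`
minimal among them, so the poles of `R_b` are confined to `S` and the relevant pole differences are `< |S| = n+1−2β_{j₂}`.
Contents (all over the tree's partial-fraction data `IsPFData b c`, no new analytic input):
* `X_pow_dvd_of_mul_left`: `X^N ∣ P·A`, `P(0) ≠ 0` ⟹ `X^N ∣ A` (over a field).
* `numS R n β j₁ j₂` — the REDUCED numerator `(2X+n)·∏_{s∉B_{j₁}}(X+s)·∏_{j≠j₁}∏_{s∈S∖B_j}(X+s)`;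
  `numR_eq_outside_mul_numS`: `numR = (∏_{s∉S}(X+s))^6 · numS` when `β_{j₂} ≤ β_j` for `j ≠ j₁`.
* `ES`, `eS0`, `zS` — the support versions of `ER`, `e0Z`, `zZ` (`not_dvd_eS0`: no prime with `n+1 ≤ p+2β_{j₂}` divides
  `e^S₀(q)`, `q ∈ S`).
* `pf_eq_zero_of_not_mem`: the pf data VANISH at `q ∉ S`; **`pf_coeff_eqS`**: `e^S₀(q)^6·c_{o,q} = zS … q (5−o)` for
  `q ∈ S` — integer numerators with denominators free of every prime `p ≥ n + 1 − 2β_{j₂}`.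
-/

noncomputable section

open Finset Polynomial

namespace Summit.KontsevichZagierPeriods.Zeta5Search.BigPrime

open Summit.KontsevichZagierPeriods.Zeta5Search.DualSeries (InBox numPoly)
open Summit.KontsevichZagierPeriods.Zeta5Search.WedgeDictionary (IsPFData)

/-! ### Cancelling a factor coprime to `X` -/

section Cancel

variable {K : Type*} [Field K]

/-- If `X^N ∣ P·A` and `P(0) ≠ 0` then `X^N ∣ A`. -/
theorem X_pow_dvd_of_mul_left {P A : K[X]} (hP : P.coeff 0 ≠ 0) {N : ℕ} (h : X ^ N ∣ P * A) : X ^ N ∣ A := by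
  induction N generalizing A with
  | zero => simp
  | succ N ih =>
    have hN : X ^ N ∣ A := ih ((pow_dvd_pow X N.le_succ).trans h)
    obtain ⟨A', rfl⟩ := hN
    have hX : (X : K[X]) ∣ P * A' := by
      have h' : X ^ N * X ∣ X ^ N * (P * A') := by
        rw [← pow_succ]; convert h using 1; ring
      exact (mul_dvd_mul_iff_left (pow_ne_zero N X_ne_zero)).1 h'
    rcases Polynomial.prime_X.dvd_or_dvd hX with hXP | hXA
    · exact absurd ((X_dvd_iff).1 hXP) hP
    · obtain ⟨A'', rfl⟩ := hXA
      exact ⟨A'', by ring⟩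

end Cancel

/-! ### The support-restricted integer model -/

section ModelS

variable (R : Type*) [CommRing R]

/-- The REDUCED numerator after dropping slot `j₁` and restricting to the support `S = block n (β j₂)`:
`Ñ = (2X + n) · ∏_{s ∈ [0,n] ∖ B_{j₁}} (X + s) · ∏_{j ≠ j₁} ∏_{s ∈ S ∖ B_j} (X + s)`. -/
def numS (n : ℕ) (β : ℕ → ℕ) (j₁ j₂ : ℕ) : R[X] :=
  (C 2 * X + C (n : R)) * (∏ s ∈ range (n + 1) \ block n (β j₁), (X + C (s : R))) *
    ∏ j ∈ (range 7).erase j₁, ∏ s ∈ block n (β j₂) \ block n (β j), (X + C (s : R))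

/-- The recentred support factors: `E^S_q = ∏_{s ∈ S, s ≠ q} (X + (s − q))^6`. -/
def ES (n : ℕ) (β : ℕ → ℕ) (j₂ q : ℕ) : R[X] :=
  ∏ s ∈ (block n (β j₂)).erase q, (X + C ((s : R) - q)) ^ 6

end ModelS

/-- `e^S₀(q) = ∏_{s ∈ S, s ≠ q} (s − q)^6 ∈ ℤ`. -/
def eS0 (n : ℕ) (β : ℕ → ℕ) (j₂ q : ℕ) : ℤ := ∏ s ∈ (block n (β j₂)).erase q, ((s : ℤ) - q) ^ 6

/-- The integers `z^S_{q,i} = [X^i](Ñ(X − q) · truncInv E^S_q 6)`. -/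
def zS (n : ℕ) (β : ℕ → ℕ) (j₁ j₂ q i : ℕ) : ℤ :=
  (taylor (-(q : ℤ)) (numS ℤ n β j₁ j₂) * truncInv (ES ℤ n β j₂ q) 6).coeff i

/-- `Ñ` is compatible with ring maps. -/
theorem numS_map {R T : Type*} [CommRing R] [CommRing T] (φ : R →+* T) (n : ℕ) (β : ℕ → ℕ) (j₁ j₂ : ℕ) :
    (numS R n β j₁ j₂).map φ = numS T n β j₁ j₂ := by
  simp only [numS, Polynomial.map_mul, Polynomial.map_add, Polynomial.map_prod, map_C, map_X]
  simp only [map_natCast, map_ofNat]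

/-- `E^S_q` is compatible with ring maps. -/
theorem ES_map {R T : Type*} [CommRing R] [CommRing T] (φ : R →+* T) (n : ℕ) (β : ℕ → ℕ) (j₂ q : ℕ) :
    (ES R n β j₂ q).map φ = ES T n β j₂ q := by
  simp only [ES, Polynomial.map_prod, Polynomial.map_pow, Polynomial.map_add, map_C, map_X]
  simp only [map_sub, map_natCast]

/-- The constant coefficient of `E^S_q` over `ℤ`. -/
theorem ES_coeff_zero (n : ℕ) (β : ℕ → ℕ) (j₂ q : ℕ) : (ES ℤ n β j₂ q).coeff 0 = eS0 n β j₂ q := by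
  rw [ES, eS0, coeff_zero_prod]
  refine prod_congr rfl fun s _ => ?_
  rw [coeff_zero_eq_eval_zero, eval_pow, eval_add, eval_X, eval_C, zero_add]

/-- `e^S₀(q) ≠ 0`. -/
theorem eS0_ne_zero (n : ℕ) (β : ℕ → ℕ) (j₂ q : ℕ) : eS0 n β j₂ q ≠ 0 := by
  rw [eS0]
  refine prod_ne_zero_iff.2 fun s hs => pow_ne_zero _ ?_
  have : s ≠ q := (mem_erase.1 hs).1
  omega

/-- No prime `p` with `|S| ≤ p` (i.e. `n + 1 ≤ p + 2β_{j₂}`) divides `e^S₀(q)` for `q ∈ S`. -/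
theorem not_dvd_eS0 {p : ℕ} (hp : p.Prime) {n : ℕ} {β : ℕ → ℕ} {j₂ : ℕ} (hS : n + 1 ≤ p + 2 * β j₂)
    {q : ℕ} (hq : q ∈ block n (β j₂)) : ¬ (p : ℤ) ∣ eS0 n β j₂ q := by
  have hpZ : Prime (p : ℤ) := Nat.prime_iff_prime_int.1 hp
  rw [eS0]
  intro h
  obtain ⟨s, hs, hdvd⟩ := (hpZ.dvd_finsetProd_iff _).1 h
  have hsq : s ≠ q ∧ s ∈ block n (β j₂) := by simpa [mem_erase] using hs
  have hs' := hsq.2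
  rw [block, mem_Icc] at hs' hq
  have h1 : (p : ℤ) ∣ (s : ℤ) - q := hpZ.dvd_of_dvd_pow hdvd
  have h2 : ((s : ℤ) - q) = 0 := by
    refine Int.eq_zero_of_dvd_of_natAbs_lt_natAbs h1 ?_
    simp only [Int.natAbs_natCast]
    omega
  omega

/-! ### Block form ⟹ reduced form -/

/-- Blocks are nested by their parameter: `β' ≤ β ⟹ block n β ⊆ block n β'`. -/
theorem block_mono {n β β' : ℕ} (h : β' ≤ β) : block n β ⊆ block n β' := by
  intro s hs
  rw [block, mem_Icc] at hs ⊢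
  omega

/-- `numR = (∏_{s ∉ S} (X + s))^6 · Ñ` when the six remaining blocks sit inside `S`. -/
theorem numR_eq_outside_mul_numS (R : Type*) [CommRing R] (n : ℕ) (β : ℕ → ℕ) {j₁ j₂ : ℕ} (hj₁ : j₁ ∈ range 7)
    (hmin : ∀ j ∈ range 7, j ≠ j₁ → β j₂ ≤ β j) :
    numR R n β = (∏ s ∈ range (n + 1) \ block n (β j₂), (X + C (s : R))) ^ 6 * numS R n β j₁ j₂ := by
  have hsplit : ∀ j ∈ (range 7).erase j₁,
      ∏ s ∈ range (n + 1) \ block n (β j), (X + C (s : R)) =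
        (∏ s ∈ range (n + 1) \ block n (β j₂), (X + C (s : R))) *
          ∏ s ∈ block n (β j₂) \ block n (β j), (X + C (s : R)) := by
    intro j hj
    have hj' := mem_erase.1 hj
    have hsub : block n (β j) ⊆ block n (β j₂) := block_mono (hmin j hj'.2 hj'.1)
    have hS : block n (β j₂) ⊆ range (n + 1) := block_subset n (β j₂)
    have hunion : range (n + 1) \ block n (β j) =
        (range (n + 1) \ block n (β j₂)) ∪ (block n (β j₂) \ block n (β j)) := by
      ext s
      simp only [mem_sdiff, mem_union]
      constructor
      · intro ⟨h1, h2⟩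
        by_cases h3 : s ∈ block n (β j₂)
        · exact Or.inr ⟨h3, h2⟩
        · exact Or.inl ⟨h1, h3⟩
      · rintro (⟨h1, h2⟩ | ⟨h1, h2⟩)
        · exact ⟨h1, fun h => h2 (hsub h)⟩
        · exact ⟨hS h1, h2⟩
    have hdisj : Disjoint (range (n + 1) \ block n (β j₂)) (block n (β j₂) \ block n (β j)) := by
      rw [Finset.disjoint_left]
      intro s hs hs'
      exact (mem_sdiff.1 hs).2 (mem_sdiff.1 hs').1
    rw [hunion, prod_union hdisj]
  rw [numR, numS, ← mul_prod_erase (range 7) _ hj₁, prod_congr rfl hsplit, prod_mul_distrib, prod_const,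
    card_erase_of_mem hj₁, card_range]
  ring

/-! ### The support-restricted Taylor identity over ℚ -/

/-- If `X^6 ∣ Σ_{o<6} C(c_o) X^{5−o}` then every `c_o = 0` (`o < 6`). -/
theorem coeffs_eq_zero_of_X_pow_dvd {c : ℕ → ℚ} (h : (X : ℚ[X]) ^ 6 ∣ ∑ o ∈ range 6, C (c o) * X ^ (5 - o))
    {o : ℕ} (ho : o < 6) : c o = 0 := by
  have hc := (X_pow_dvd_iff.1 h) (5 - o) (by omega)
  rw [finsetSum_coeff, sum_eq_single o] at hc
  · simpa [coeff_C_mul, coeff_X_pow] using hc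
  · intro o' ho' hne
    have hne' : 5 - o ≠ 5 - o' := by have := mem_range.1 ho'; omega
    simp [coeff_C_mul, coeff_X_pow, hne']
  · intro h'; exact absurd (mem_range.2 ho) h'

/-- The partial-fraction data VANISH off the support `S` (those poles of the written form are cancelled). -/
theorem pf_eq_zero_of_not_mem (b : ℕ → ℤ) (hb : InBox b) (hhalf : ∀ j ∈ range 7, 2 * b (j + 1) ≤ b 0 + 1)
    {c : ℕ → ℕ → ℚ} (hc : IsPFData b c) {j₁ j₂ : ℕ} (hj₁ : j₁ ∈ range 7)
    (hmin : ∀ j ∈ range 7, j ≠ j₁ → (b (j₂ + 1)).toNat ≤ (b (j + 1)).toNat)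
    {q : ℕ} (hq : q ≤ (b 0).toNat) (hqS : q ∉ block (b 0).toNat (b (j₂ + 1)).toNat) {o : ℕ} (ho : o < 6) :
    c o q = 0 := by
  set n := (b 0).toNat with hn
  set β : ℕ → ℕ := fun j => (b (j + 1)).toNat with hβ
  have h1 := taylor_numPoly_congr b hc hq
  rw [numPoly_eq_numR b hb hhalf, numR_eq_outside_mul_numS ℚ n β hj₁ hmin, taylor_mul, taylor_pow,
    taylor_prod'] at h1
  -- the outside product contains the factor at `s = q`, which shifts to `X`
  have hmem : q ∈ range (n + 1) \ block n (β j₂) := mem_sdiff.2 ⟨mem_range.2 (by omega), hqS⟩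
  have hX6 : (X : ℚ[X]) ^ 6 ∣
      (∏ s ∈ range (n + 1) \ block n (β j₂), taylor (-(q : ℚ)) (X + C (s : ℚ))) ^ 6 := by
    refine pow_dvd_pow_of_dvd ?_ 6
    have hfac : taylor (-(q : ℚ)) (X + C (q : ℚ)) = X := by rw [taylor_X_add_C, add_neg_cancel, C_0, add_zero]
    exact (dvd_of_eq hfac.symm).trans
      (Finset.dvd_prod_of_mem (fun s : ℕ => taylor (-(q : ℚ)) (X + C (s : ℚ))) hmem)
  have h2 : (X : ℚ[X]) ^ 6 ∣ ER ℚ n q * (∑ o ∈ range 6, C (c o q) * X ^ (5 - o)) := by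
    have h3 := (hX6.mul_right (taylor (-(q : ℚ)) (numS ℚ n β j₁ j₂)))
    have := dvd_sub h3 h1
    rw [sub_sub_cancel, mul_comm] at this
    exact this
  have hE : (ER ℚ n q).coeff 0 ≠ 0 := by
    rw [← ER_map (Int.castRingHom ℚ), coeff_map, ER_coeff_zero]
    simpa using e0Z_ne_zero n q
  have h4 : (X : ℚ[X]) ^ 6 ∣ ∑ o ∈ range 6, C (c o q) * X ^ (5 - o) := X_pow_dvd_of_mul_left hE h2
  exact coeffs_eq_zero_of_X_pow_dvd (c := fun o => c o q) h4 ho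

/-- **Support-restricted Taylor identity**: for `q ∈ S`, `e^S₀(q)^6 · c_{o,q} = z^S_{q,5−o}`. -/
theorem pf_coeff_eqS (b : ℕ → ℤ) (hb : InBox b) (hhalf : ∀ j ∈ range 7, 2 * b (j + 1) ≤ b 0 + 1)
    {c : ℕ → ℕ → ℚ} (hc : IsPFData b c) {j₁ j₂ : ℕ} (hj₁ : j₁ ∈ range 7)
    (hmin : ∀ j ∈ range 7, j ≠ j₁ → (b (j₂ + 1)).toNat ≤ (b (j + 1)).toNat)
    {q : ℕ} (hqS : q ∈ block (b 0).toNat (b (j₂ + 1)).toNat) {o : ℕ} (ho : o < 6) :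
    ((eS0 (b 0).toNat (fun j => (b (j + 1)).toNat) j₂ q : ℤ) : ℚ) ^ 6 * c o q =
      (zS (b 0).toNat (fun j => (b (j + 1)).toNat) j₁ j₂ q (5 - o) : ℚ) := by
  set n := (b 0).toNat with hn
  set β : ℕ → ℕ := fun j => (b (j + 1)).toNat with hβ
  have hq : q ≤ n := by have := block_subset n (β j₂) hqS; rw [mem_range] at this; omega
  set Sq : ℚ[X] := ∑ o ∈ range 6, C (c o q) * X ^ (5 - o) with hSq
  set Out : ℚ[X] := (∏ s ∈ range (n + 1) \ block n (β j₂), taylor (-(q : ℚ)) (X + C (s : ℚ))) ^ 6 with hOut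
  have h1 := taylor_numPoly_congr b hc hq
  rw [numPoly_eq_numR b hb hhalf, numR_eq_outside_mul_numS ℚ n β hj₁ hmin, taylor_mul, taylor_pow,
    taylor_prod'] at h1
  -- split `ER` along `S`: (range \ S) ∪ (S.erase q)
  have hER : ER ℚ n q = Out * ES ℚ n β j₂ q := by
    have hsplit : (range (n + 1)).erase q = (range (n + 1) \ block n (β j₂)) ∪ (block n (β j₂)).erase q := by
      ext s
      simp only [mem_erase, mem_sdiff, mem_union]
      constructor
      · intro ⟨h1, h2⟩
        by_cases h3 : s ∈ block n (β j₂)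
        · exact Or.inr ⟨h1, h3⟩
        · exact Or.inl ⟨h2, h3⟩
      · rintro (⟨h1, h2⟩ | ⟨h1, h2⟩)
        · exact ⟨fun h => h2 (h ▸ hqS), h1⟩
        · exact ⟨h1, block_subset n (β j₂) h2⟩
    have hdisj : Disjoint (range (n + 1) \ block n (β j₂)) ((block n (β j₂)).erase q) := by
      rw [Finset.disjoint_left]
      intro s hs hs'
      exact (mem_sdiff.1 hs).2 (mem_erase.1 hs').2
    have hOut' : Out = ∏ s ∈ range (n + 1) \ block n (β j₂), (X + C ((s : ℚ) - q)) ^ 6 := by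
      rw [hOut, ← prod_pow]
      exact prod_congr rfl fun s _ => by rw [taylor_X_add_C, sub_eq_add_neg]
    rw [ER, hsplit, prod_union hdisj, hOut', ES]
  rw [hER] at h1
  have h2 : (X : ℚ[X]) ^ 6 ∣ Out * (taylor (-(q : ℚ)) (numS ℚ n β j₁ j₂) - Sq * ES ℚ n β j₂ q) := by
    have : Out * (taylor (-(q : ℚ)) (numS ℚ n β j₁ j₂) - Sq * ES ℚ n β j₂ q) =
        Out * taylor (-(q : ℚ)) (numS ℚ n β j₁ j₂) - Sq * (Out * ES ℚ n β j₂ q) := by ring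
    rw [this]; exact h1
  have hOut0 : Out.coeff 0 ≠ 0 := by
    rw [hOut, coeff_zero_eq_eval_zero, eval_pow, eval_prod]
    refine pow_ne_zero _ (prod_ne_zero_iff.2 fun s hs => ?_)
    rw [taylor_X_add_C, eval_add, eval_X, eval_C, zero_add]
    have hsq : s ≠ q := fun h => (mem_sdiff.1 hs).2 (h ▸ hqS)
    have : (s : ℚ) - q ≠ 0 := by
      have : (s : ℚ) ≠ q := by exact_mod_cast hsq
      exact sub_ne_zero.2 this
    rwa [← sub_eq_add_neg]
  have h3 : (X : ℚ[X]) ^ 6 ∣ taylor (-(q : ℚ)) (numS ℚ n β j₁ j₂) - Sq * ES ℚ n β j₂ q :=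
    X_pow_dvd_of_mul_left hOut0 h2
  -- multiply by the truncated inverse
  set J : ℚ[X] := truncInv (ES ℚ n β j₂ q) 6 with hJ
  have h4 := truncInv_spec (ES ℚ n β j₂ q) 6
  have he0 : (ES ℚ n β j₂ q).coeff 0 = (eS0 n β j₂ q : ℚ) := by
    rw [← ES_map (Int.castRingHom ℚ), coeff_map, ES_coeff_zero]; simp
  have h5 : (X : ℚ[X]) ^ 6 ∣ taylor (-(q : ℚ)) (numS ℚ n β j₁ j₂) * J - Sq * C ((eS0 n β j₂ q : ℚ) ^ 6) := by
    have : taylor (-(q : ℚ)) (numS ℚ n β j₁ j₂) * J - Sq * C ((eS0 n β j₂ q : ℚ) ^ 6) =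
        (taylor (-(q : ℚ)) (numS ℚ n β j₁ j₂) - Sq * ES ℚ n β j₂ q) * J +
          Sq * (ES ℚ n β j₂ q * J - C ((ES ℚ n β j₂ q).coeff 0 ^ 6)) := by
      rw [he0]; ring
    rw [this]
    exact dvd_add (h3.mul_right J) (h4.mul_left Sq)
  have h6 := coeff_eq_of_X_pow_dvd_sub h5 (show 5 - o < 6 by omega)
  have hL : taylor (-(q : ℚ)) (numS ℚ n β j₁ j₂) * J =
      (taylor (-(q : ℤ)) (numS ℤ n β j₁ j₂) * truncInv (ES ℤ n β j₂ q) 6).map (Int.castRingHom ℚ) := by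
    rw [Polynomial.map_mul, map_taylor, numS_map, truncInv_map, ES_map]
    simp [hJ]
  have hR : (Sq * C ((eS0 n β j₂ q : ℚ) ^ 6)).coeff (5 - o) = ((eS0 n β j₂ q : ℤ) : ℚ) ^ 6 * c o q := by
    rw [hSq, sum_mul, finsetSum_coeff, sum_eq_single o]
    · simp only [coeff_mul_C, coeff_C_mul, coeff_X_pow, if_true]; ring
    · intro o' ho' hne
      have hne' : 5 - o ≠ 5 - o' := by have := mem_range.1 ho'; omega
      simp only [coeff_mul_C, coeff_C_mul, coeff_X_pow, if_neg hne']; ring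
    · intro h; exact absurd (mem_range.2 ho) h
  rw [hL, coeff_map, hR] at h6
  rw [← h6, zS]
  simp

end Summit.KontsevichZagierPeriods.Zeta5Search.BigPrime

end
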